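import Summits.CriticalPhenomena.SAWScalingLimit.Theorems.BoundaryClosureNegative_HalfDisc
import Literature.Topology.PlaneTopology.ArcLoops
import Literature.Probability.RandomPlanarGeometry.ConformalRestrictionProofs
import HarnessLib

/-!
# Crux `SAWDevelopingMap.ObservableToSLE` (stmt-CriticalPhenomena-10472), line
`floor-ratio-restriction-bootstrap`, stub `stub_canonicalTransfer`: the half-disc FLOOR
SUPER-DOMAIN of a floor domain (geometric input of the canonical insensitivity (CI))

Landing target:
`Summits/CriticalPhenomena/SAWScalingLimit/Theorems/SAWDevelopingMapObservableToSLECanonicalTransferHalfDisc.lean`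
(`--supports stmt-CriticalPhenomena-10472`).

The remaining input (CI) of `canonicalTransfer_of_hypotheses` (`…CanonicalTransferReduction`) —
canonical critical SAWs of a floor domain `D` stay inside the inner admissible family — is to be
obtained from the admissible restriction limit applied in a FLOOR SUPER-DOMAIN of `D` of which `D`
is a hull subdomain.  This file provides that super-domain: a half-disc on the floor line with the
same two marked points.

* `exists_affineHomeomorph` — the affine homeomorphisms `z ↦ c + R (σ Re z + i Im z)`, `σ = ±1`;
* `exists_halfDisc_dobrushinDomain` = registered sub-goal `stub_canonicalTransfer_halfDisc` — **for
  two distinct points `p₀`, `p₁` on a horizontal line and `R > |Re p₀ - Re p₁|` there is a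
  Dobrushin domain with carrier the open upper half-disc of radius `R` centred between them and
  marked points `p₀`, `p₁`** (image of the tree's unit half-disc `halfDiscJordan` under an affine
  homeomorphism, marks on the diameter);
* `isHullSubdomain_of_flat` — a subdomain with the same marked points which agrees with the
  domain near them is a hull subdomain (so a floor domain is a hull subdomain of every such
  half-disc containing it).
-/

noncomputable section

open scoped Topology
open Filter Set Metric
open Literature.Probability.RandomPlanarGeometry
open Summit.CriticalPhenomena.SAWScalingLimit.Theorems.BoundaryClosure.Negative
  (HD halfDiscJordan bdry bdryFun bdry_eq_of_mem bdryFun_of_gt)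

namespace Summit.CriticalPhenomena.SAWScalingLimit.Theorems.ObservableToSLE.FloorRatio

/-- **Affine homeomorphisms of the plane preserving horizontals**: for `c ∈ ℂ`, `R > 0` and
`σ = ±1`, `z ↦ c + R (σ Re z + i Im z)` is a homeomorphism of `ℂ`. [folklore] -/
theorem exists_affineHomeomorph (c : ℂ) {R : ℝ} (hR : 0 < R) {σ : ℝ} (hσ : σ = 1 ∨ σ = -1) :
    ∃ F : ℂ ≃ₜ ℂ, ∀ z : ℂ, F z = c + (R : ℂ) * (((σ * z.re : ℝ) : ℂ) + ((z.im : ℝ) : ℂ) * Complex.I) := by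
  have hR0 : (R : ℂ) ≠ 0 := Complex.ofReal_ne_zero.2 hR.ne'
  rcases hσ with rfl | rfl
  · refine ⟨(Homeomorph.mulLeft₀ (R : ℂ) hR0).trans (Homeomorph.addLeft c), fun z => ?_⟩
    show c + (R : ℂ) * z = _
    rw [one_mul, Complex.re_add_im]
  · refine ⟨((Homeomorph.neg ℂ).trans Complex.conjCLE.toHomeomorph).trans
      ((Homeomorph.mulLeft₀ (R : ℂ) hR0).trans (Homeomorph.addLeft c)), fun z => ?_⟩
    show c + (R : ℂ) * (Complex.conjCLE (-z)) = _
    congr 1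
    congr 1
    apply Complex.ext <;> simp

/-- **The half-disc Dobrushin domain on a horizontal line with two prescribed marked points**
(named form of the registered sub-goal `stub_canonicalTransfer_halfDisc`). [folklore] -/
theorem exists_halfDisc_dobrushinDomain {h : ℝ} {p₀ p₁ : ℂ} (hp₀ : p₀.im = h) (hp₁ : p₁.im = h)
    (hne : p₀.re ≠ p₁.re) {R : ℝ} (hR : |p₀.re - p₁.re| < R) :
    ∃ H : DobrushinDomain,
      H.carrier = {z : ℂ | h < z.im} ∩ ball (⟨(p₀.re + p₁.re) / 2, h⟩ : ℂ) R ∧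
      H.pt 0 = p₀ ∧ H.pt 1 = p₁ := by
  set c : ℂ := ⟨(p₀.re + p₁.re) / 2, h⟩ with hc
  set d : ℝ := (p₀.re - p₁.re) / 2 with hd
  have hd0 : d ≠ 0 := by rw [hd]; intro h0; apply hne; linarith
  have hRpos : 0 < R := (abs_nonneg _).trans_lt hR
  have hdR : |d| < R / 2 := by
    rw [hd, abs_div, abs_of_pos (by norm_num : (0:ℝ) < 2)]; linarith
  set σ : ℝ := if 0 < d then 1 else -1 with hσ
  have hσ1 : σ = 1 ∨ σ = -1 := by rw [hσ]; split_ifs <;> simp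
  have hσd : σ * |d| = d := by
    rw [hσ]; split_ifs with h0
    · rw [one_mul, abs_of_pos h0]
    · rw [abs_of_neg (lt_of_le_of_ne (not_lt.1 h0) hd0)]; ring
  have hσsq : σ * σ = 1 := by rcases hσ1 with h1 | h1 <;> rw [h1] <;> norm_num
  obtain ⟨F, hF⟩ := exists_affineHomeomorph c hRpos hσ1
  set x₀ : ℝ := |d| / R with hx₀
  have hx₀0 : 0 < x₀ := div_pos (abs_pos.2 hd0) hRpos
  have hx₀1 : x₀ < 1 / 2 := by rw [hx₀, div_lt_iff₀ hRpos]; linarith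
  -- the real points `± x₀` of the unit half-disc are sent to `p₀`, `p₁`
  have hFx : ∀ (x : ℝ), F (x : ℂ) = c + (((R * σ * x : ℝ) : ℂ)) := by
    intro x
    rw [hF]
    simp only [Complex.ofReal_re, Complex.ofReal_im, Complex.ofReal_zero, zero_mul, add_zero]
    push_cast; ring
  have hp₀' : F (x₀ : ℂ) = p₀ := by
    rw [hFx, hx₀, show R * σ * (|d| / R) = σ * |d| by field_simp, hσd]
    apply Complex.ext
    · simp [hc, hd]; ring
    · simp [hc, hp₀]
  have hp₁' : F ((-x₀ : ℝ) : ℂ) = p₁ := by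
    rw [hFx, hx₀, show R * σ * -(|d| / R) = -(σ * |d|) by field_simp, hσd]
    apply Complex.ext
    · simp [hc, hd]; ring
    · simp [hc, hp₁]
  -- the carrier
  have hFmem : ∀ z : ℂ, F z ∈ {z : ℂ | h < z.im} ∩ ball c R ↔ z ∈ HD := by
    intro z
    have him : (F z).im = h + R * z.im := by rw [hF]; simp [hc]
    have hdist : dist (F z) c = R * ‖z‖ := by
      rw [dist_eq_norm, hF, add_sub_cancel_left, norm_mul, Complex.norm_real, Real.norm_of_nonneg hRpos.le]
      congr 1
      rw [Complex.norm_eq_sqrt_sq_add_sq, Complex.norm_eq_sqrt_sq_add_sq]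
      congr 1
      simp only [Complex.add_re, Complex.ofReal_re, Complex.mul_re, Complex.I_re, mul_zero,
        Complex.ofReal_im, Complex.I_im, mul_one, sub_self, add_zero, Complex.add_im, Complex.mul_im,
        zero_add]
      nlinarith [hσsq]
    simp only [mem_inter_iff, mem_setOf_eq, mem_ball, him, hdist, HD]
    constructor
    · rintro ⟨h1, h2⟩
      exact ⟨by nlinarith, by nlinarith⟩
    · rintro ⟨h1, h2⟩
      exact ⟨by nlinarith, by nlinarith⟩
  refine ⟨{ toJordanDomain := halfDiscJordan.imageHomeomorph F
            mark := ![(3 - x₀) / 4, (3 + x₀) / 4]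
            strictMono_mark := Fin.strictMono_iff_lt_succ.2 fun k => by
              fin_cases k
              simp; linarith
            mark_mem := fun k => by
              fin_cases k
              · simp; constructor <;> linarith
              · simp; constructor <;> linarith }, ?_, ?_, ?_⟩
  · -- carrier
    show F '' HD = _
    ext w
    constructor
    · rintro ⟨z, hz, rfl⟩
      exact (hFmem z).2 hz
    · intro hw
      exact ⟨F.symm w, (hFmem _).1 (by rwa [F.apply_symm_apply]), F.apply_symm_apply w⟩
  · show F (bdry ((3 - x₀) / 4)) = p₀
    rw [bdry_eq_of_mem ⟨by linarith, by linarith⟩, bdryFun_of_gt (by linarith),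
      show (3 - 4 * ((3 - x₀) / 4) : ℝ) = x₀ by ring, hp₀']
  · show F (bdry ((3 + x₀) / 4)) = p₁
    rw [bdry_eq_of_mem ⟨by linarith, by linarith⟩, bdryFun_of_gt (by linarith),
      show (3 - 4 * ((3 + x₀) / 4) : ℝ) = -x₀ by ring, hp₁']

/-- **Subdomains agreeing near the marked points are hull subdomains**: if `D ⊆ H` have the same
marked points and `H ∩ B(pt i, ρ) ⊆ D` for `i = 0, 1` (`ρ > 0`), then `D` is a hull subdomain
of `H` (the removed part `H ∖ D` misses both balls). [folklore] -/
theorem isHullSubdomain_of_flat {H D : DobrushinDomain} {ρ : ℝ} (hρ : 0 < ρ)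
    (hDH : D.carrier ⊆ H.carrier) (h0 : D.pt 0 = H.pt 0) (h1 : D.pt 1 = H.pt 1)
    (hfl0 : H.carrier ∩ ball (H.pt 0) ρ ⊆ D.carrier) (hfl1 : H.carrier ∩ ball (H.pt 1) ρ ⊆ D.carrier) :
    H.IsHullSubdomain D := by
  have key : ∀ {p : ℂ}, H.carrier ∩ ball p ρ ⊆ D.carrier → p ∉ closure (H.carrier \ D.carrier) := by
    intro p hfl hp
    rw [Metric.mem_closure_iff] at hp
    obtain ⟨z, ⟨hzH, hzD⟩, hz⟩ := hp ρ hρ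
    exact hzD (hfl ⟨hzH, by rwa [mem_ball, dist_comm]⟩)
  exact ⟨hDH, h0, h1, key hfl0, key hfl1⟩

/-- **Registered sub-goal `stub_canonicalTransfer_halfDisc`** (crux item stmt-CriticalPhenomena-10472,
stub `stub_canonicalTransfer`): the half-disc Dobrushin domain with two prescribed marked points on
its diameter, registry form of `exists_halfDisc_dobrushinDomain`. [folklore] -/
theorem stub_canonicalTransfer_halfDisc :
    ∀ (h R : ℝ) (p₀ p₁ : ℂ), p₀.im = h → p₁.im = h → p₀.re ≠ p₁.re → |p₀.re - p₁.re| < R →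
    ∃ H : DobrushinDomain,
      H.carrier = {z : ℂ | h < z.im} ∩ ball (⟨(p₀.re + p₁.re) / 2, h⟩ : ℂ) R ∧
      H.pt 0 = p₀ ∧ H.pt 1 = p₁ :=
  fun _ _ _ _ hp₀ hp₁ hne hR => exists_halfDisc_dobrushinDomain hp₀ hp₁ hne hR

end Summit.CriticalPhenomena.SAWScalingLimit.Theorems.ObservableToSLE.FloorRatio

end
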